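import Summits.BirchSwinnertonDyer.BirchSwinnertonDyer.Theorems.KimAtThreeFineKatoKPortJunctionLog
import Summits.BirchSwinnertonDyer.BirchSwinnertonDyer.Theorems.KimAtThreeFineKatoKPortLogSurjective
import HarnessLib

/-!
# K-PORT junction (J4f): `log_ω(E₁(L_w)) = p𝒪_w` at an UNRAMIFIED place `w ∣ p`, `p` odd, for the Literature
# logarithm `padicLogPointFiniteExt ν (W.baseChange L_w) p` and EVERY compatible `ν` — any reduction type
# (cell `bsd-addord`, seat w2-kport gen 5; `--supports stmt-BirchSwinnertonDyer-19560`, helper)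

HONEST FRAMING. Route W2 (`route-BirchSwinnertonDyer-KimAtThreeKolyvagin`), crux 19560
`KatoKuriharaPortThreeShared`, off-stratum items 19679 / 19599 and support item 20397
`FineKatoTauAnomalousThree` (good-ANOMALOUS rows): the E-side LATTICE LEMMA `log_ω(E(K) ⊗ ℤ_p) =
E_p(φ)⁻¹𝒪_K` (w2-acc3: Part A `Literature/…/PadicLogEulerOperatorProofs`, index
`Theorems/KimAtThreeEulerLatticeIndex`) needs, at its top layer, **`log_ω(E₁(L_w)) = p𝒪_w`** for the number
field's completion `L_w` at an unramified `w ∣ p` and the curve `W ⊗ L_w` with GOOD (not additive) reduction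
— Silverman IV.6.4(b) at `r = v(p) = 1`.  Gen 5's (G6) `…KPortLogSurjective` proves it in kport's abstract
currency (`K` complete ultrametric over `ℚ_[p]`, `Λ̃ = satLog` on `curveK p K W_ℤ`); THIS FILE moves it across
gen 3's junction (J4a–c) to the Literature currency the lattice lemma is written in:
`K = w.1.adicCompletion L`, `log_ω = FormalGroupChart.padicLogPointFiniteExt ν (W.baseChange L_w) p`,
`E₁(L_w) = FormalGroupChart.kernel ν (W.baseChange L_w)`, for EVERY `ℝ≥0`-valued valuation `ν` of `L_w`
compatible with its valuative relation (the `[ν.Compatible]` binder of (S5b); all such `ν` are equivalent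
to kport's base-`p` norm on the synonym `Kw p L w`, (J2) `Kw.valuation_isEquiv_of_compatible`).
TOOL theorems only (no definition, no named fact, no instance, no `sorry`; axioms standard); closes nothing
by itself; nothing is booked; BSD is not proved by any of this.

## What is proved (namespace `…Theorems.KPort.Kw`; `L : Type` a number field, `w` a place of `L` above `p`)

* §1 (any field): `exists_mem_kernel_padicLogPointFiniteExt_eq_of_eq` — transport of a point of `E₁` along an
  equality of models keeps `E₁`-membership and `log_ω` (`subst`); `mem_kernel_comap_toCompletion_iff` — the
  kernel of reduction of an equation over `L_w` for `ν` IS its kernel for `ν` read on the synonym `K_w` (`Iff.rfl`).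
* §2 (`[Fact (e(w ∣ p) = 1)]`, `W/ℚ` globally minimal, `ν` compatible):
  `exists_mem_kernel_padicLogPointFiniteExt_eq_satLog` — every `P ∈ E₁(K_w)` of kport's model is a
  `P′ ∈ E₁^{ν}(W ⊗ L_w)` with `log_ω^{ν} P′ = Λ̃ P` (gen 3's `exists_point_padicLogPointFiniteExt_eq_satLog`
  with the kernel clause kept); `exists_mem_kernel_satLog_eq_padicLogPointFiniteExt` — the converse transport.
* §3 (`p` odd): ★ **`exists_mem_kernel_padicLogPointFiniteExt_eq_of_val_le`** — every `y ∈ L_w` with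
  `ν y ≤ ν p` is `log_ω^{ν}(P′)` for some `P′ ∈ E₁^{ν}(W ⊗ L_w)`; **`val_padicLogPointFiniteExt_le_of_mem_kernel`**
  — `ν(log_ω^{ν} P′) ≤ ν p` on `E₁^{ν}(W ⊗ L_w)`; ★★ **`image_padicLogPointFiniteExt_kernel_eq`** —
  `log_ω^{ν} '' E₁^{ν}(W ⊗ L_w) = {y : ν y ≤ ν p}` (= `p𝒪_w`), EVERY reduction type of `W` at `p`.

References: J. H. Silverman, *The Arithmetic of Elliptic Curves*, 2nd ed., GTM 106 (2009), Thm. IV.6.4(b),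
Prop. VII.2.2 [SilvermanAEC2009]; J.-P. Serre, *Local Fields* (1979), Ch. II §1 [SerreLocalFields1979].
-/

noncomputable section

-- the cell's Theorems namespace `Summit.BirchSwinnertonDyer.BirchSwinnertonDyer.…` repeats the summit name by design (D-0017)
set_option linter.dupNamespace false

open scoped NNReal NumberField Classical
open IsDedekindDomain NumberField

namespace Summit.BirchSwinnertonDyer.BirchSwinnertonDyer.Theorems.KPort

open Summit.BirchSwinnertonDyer.Rank1Residual.Additive Summit.BirchSwinnertonDyer.Rank1Residual.Additive.BallEval
open Literature.NumberTheory.EllipticCurves.Rank1Residual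
open Literature.NumberTheory.EllipticCurves Literature.NumberTheory.EllipticCurves.FormalGroupChart
open WeierstrassCurve

namespace Kw

variable {p : ℕ} [hp : Fact p.Prime] {L : Type} [Field L] [NumberField L]
  (w : ((Rat.HeightOneSpectrum.primesEquiv (R := 𝓞 ℚ)).symm ⟨p, hp.out⟩).Extension (𝓞 L))

/-! ## §1 Transport of `E₁`-membership along an equality of models; the kernel read on `K_w` -/

/-- **Transport along an equality of models, with the kernel**: for `h : V = V'` over one field, a point
`P ∈ E₁(V)` is a point `P′ ∈ E₁(V')` with the same logarithm (`subst`; no arithmetic). [folklore] -/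
theorem exists_mem_kernel_padicLogPointFiniteExt_eq_of_eq {F : Type*} [Field F] (ν : Valuation F ℝ≥0)
    {V V' : WeierstrassCurve F} (h : V = V') [V.IsIntegral ν.integer] [V'.IsIntegral ν.integer] (q : ℕ)
    {P : V.toAffine.Point} (hP : P ∈ kernel ν V) :
    ∃ P' : V'.toAffine.Point, P' ∈ kernel ν V' ∧
      padicLogPointFiniteExt ν V' q P' = padicLogPointFiniteExt ν V q P := by
  subst h
  exact ⟨P, hP, rfl⟩

/-- Reading `E₁` on `K_w`: the kernel of reduction of an equation over `L_w` for `ν` is, as a set of points,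
its kernel for `ν` read on the synonym `K_w` (`ν.comap Kw.toCompletion`; definitionally). [folklore] -/
theorem mem_kernel_comap_toCompletion_iff (ν : Valuation (w.1.adicCompletion L) ℝ≥0)
    (V : WeierstrassCurve (w.1.adicCompletion L)) [hV : V.IsIntegral ν.integer] (P : V.toAffine.Point) :
    P ∈ @kernel (Kw p L w) (Kw.instField p L w) (ν.comap (toCompletion p L w).toRingHom) V
        (isIntegral_comap_toCompletion (p := p) w ν V) ↔ P ∈ kernel ν V :=
  Iff.rfl

/-! ## §2 `E₁(K_w)` of kport's model ↔ `E₁^{ν}(W ⊗ L_w)`, with logarithms -/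

section Log

variable [he : Fact (w.1.asIdeal.ramificationIdx (𝓞 ℚ) = 1)] (W : WeierstrassCurve ℚ) [W.IsGloballyMinimal]
  [hE : (((integralModelInt W).map (Int.castRingHom ℤ_[p])).map PadicInt.Coe.ringHom).IsElliptic]
  [hint : (curveK p (Kw p L w) ((integralModelInt W).map (Int.castRingHom ℤ_[p]))).IsIntegral
    (NormedField.valuation (K := Kw p L w)).integer]
  (ν : Valuation (w.1.adicCompletion L) ℝ≥0) [ν.Compatible]
  [hν : (W.baseChange (w.1.adicCompletion L)).IsIntegral ν.integer]

/-- **Every point of `E₁(K_w)` (kport's model, base-`p` norm) is a point `P′ ∈ E₁^{ν}(W ⊗ L_w)` with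
`log_ω^{ν}(P′) = Λ̃(P)`**, for every compatible `ν` (gen 3's `exists_point_padicLogPointFiniteExt_eq_satLog`
keeping the kernel clause: (J4b) `kernel_eq_of_isEquiv`, §1). [cite: SilvermanAEC2009, Thm. IV.6.4 with Prop. VII.2.2] -/
theorem exists_mem_kernel_padicLogPointFiniteExt_eq_satLog
    {P : (curveK p (Kw p L w) ((integralModelInt W).map (Int.castRingHom ℤ_[p]))).toAffine.Point}
    (hP : P ∈ kernel (NormedField.valuation (K := Kw p L w))
      (curveK p (Kw p L w) ((integralModelInt W).map (Int.castRingHom ℤ_[p])))) :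
    ∃ P' : (W.baseChange (w.1.adicCompletion L)).toAffine.Point,
      P' ∈ kernel ν (W.baseChange (w.1.adicCompletion L)) ∧
      padicLogPointFiniteExt ν (W.baseChange (w.1.adicCompletion L)) p P' =
        toCompletion p L w (satLog p (Kw p L w) ((integralModelInt W).map (Int.castRingHom ℤ_[p])) P) := by
  have hC := curveK_integralModelInt_eq_baseChange (p := p) w W
  have hequiv := valuation_isEquiv_of_compatible (p := p) w ν
  haveI hν₁ : (curveK p (Kw p L w) ((integralModelInt W).map (Int.castRingHom ℤ_[p]))).IsIntegral
      (ν.comap (toCompletion p L w).toRingHom).integer :=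
    isIntegral_of_isEquiv hequiv _
  haveI hν₂ := isIntegral_comap_toCompletion (p := p) w ν (W.baseChange (w.1.adicCompletion L))
  have hPν : P ∈ kernel (ν.comap (toCompletion p L w).toRingHom)
      (curveK p (Kw p L w) ((integralModelInt W).map (Int.castRingHom ℤ_[p]))) := by
    rw [← kernel_eq_of_isEquiv hequiv]
    exact hP
  obtain ⟨P', hP'k, hP'l⟩ :=
    exists_mem_kernel_padicLogPointFiniteExt_eq_of_eq (ν.comap (toCompletion p L w).toRingHom) hC p hPν
  refine ⟨P', (mem_kernel_comap_toCompletion_iff (p := p) w ν _ P').mp hP'k, ?_⟩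
  rw [← padicLogPointFiniteExt_comap_toCompletion (p := p) w ν (W.baseChange (w.1.adicCompletion L)) p P', hP'l,
    toCompletion_apply, satLog_eq_padicLogPointFiniteExt, padicLogPointFiniteExt_apply_eq_of_isEquiv hequiv p P]

/-- **The converse transport**: every `P′ ∈ E₁^{ν}(W ⊗ L_w)` is a point `P ∈ E₁(K_w)` of kport's model with
`Λ̃(P) = log_ω^{ν}(P′)`. [cite: SilvermanAEC2009, Thm. IV.6.4 with Prop. VII.2.2] -/
theorem exists_mem_kernel_satLog_eq_padicLogPointFiniteExt
    {P' : (W.baseChange (w.1.adicCompletion L)).toAffine.Point}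
    (hP' : P' ∈ kernel ν (W.baseChange (w.1.adicCompletion L))) :
    ∃ P : (curveK p (Kw p L w) ((integralModelInt W).map (Int.castRingHom ℤ_[p]))).toAffine.Point,
      P ∈ kernel (NormedField.valuation (K := Kw p L w))
        (curveK p (Kw p L w) ((integralModelInt W).map (Int.castRingHom ℤ_[p]))) ∧
      toCompletion p L w (satLog p (Kw p L w) ((integralModelInt W).map (Int.castRingHom ℤ_[p])) P) =
        padicLogPointFiniteExt ν (W.baseChange (w.1.adicCompletion L)) p P' := by
  have hC := curveK_integralModelInt_eq_baseChange (p := p) w W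
  have hequiv := valuation_isEquiv_of_compatible (p := p) w ν
  haveI hν₁ : (curveK p (Kw p L w) ((integralModelInt W).map (Int.castRingHom ℤ_[p]))).IsIntegral
      (ν.comap (toCompletion p L w).toRingHom).integer :=
    isIntegral_of_isEquiv hequiv _
  haveI hν₂ := isIntegral_comap_toCompletion (p := p) w ν (W.baseChange (w.1.adicCompletion L))
  have hP'ν : P' ∈ @kernel (Kw p L w) (Kw.instField p L w) (ν.comap (toCompletion p L w).toRingHom)
      (W.baseChange (w.1.adicCompletion L)) hν₂ :=
    (mem_kernel_comap_toCompletion_iff (p := p) w ν _ P').mpr hP'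
  obtain ⟨P, hPk, hPl⟩ :=
    exists_mem_kernel_padicLogPointFiniteExt_eq_of_eq (ν.comap (toCompletion p L w).toRingHom) hC.symm p hP'ν
  refine ⟨P, ?_, ?_⟩
  · rw [kernel_eq_of_isEquiv hequiv]
    exact hPk
  · rw [toCompletion_apply, satLog_eq_padicLogPointFiniteExt, padicLogPointFiniteExt_apply_eq_of_isEquiv hequiv p P,
      hPl, ← padicLogPointFiniteExt_comap_toCompletion (p := p) w ν (W.baseChange (w.1.adicCompletion L)) p P']

/-! ## §3 `p` odd: `log_ω^{ν}(E₁^{ν}(W ⊗ L_w)) = p𝒪_w` at an unramified `w`, any reduction -/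

omit he hν in
/-- The hypothesis `ν y ≤ ν p` read on `K_w`: `‖y‖ ≤ ‖p‖` for the base-`p` norm (the valuations are
equivalent, (J2)). [cite: SerreLocalFields1979, Ch. II §1] -/
theorem norm_le_norm_prime_of_val_le {y : w.1.adicCompletion L}
    (hy : ν y ≤ ν ((p : ℕ) : w.1.adicCompletion L)) :
    ‖((toCompletion p L w).symm y : Kw p L w)‖ ≤ ‖((p : ℕ) : Kw p L w)‖ := by
  have hequiv := valuation_isEquiv_of_compatible (p := p) w ν
  have h1 : (ν.comap (toCompletion p L w).toRingHom) ((toCompletion p L w).symm y) ≤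
      (ν.comap (toCompletion p L w).toRingHom) ((p : ℕ) : Kw p L w) := by
    rw [Valuation.comap_apply, Valuation.comap_apply, map_natCast]
    exact hy
  have h2 := (hequiv _ _).mpr h1
  rw [NormedField.valuation_apply, NormedField.valuation_apply] at h2
  have h3 : ((‖(toCompletion p L w).symm y‖₊ : ℝ≥0) : ℝ) ≤ ‖((p : ℕ) : Kw p L w)‖₊ := NNReal.coe_le_coe.mpr h2
  simpa only [coe_nnnorm] using h3

omit he hν in
/-- Conversely `‖x‖ ≤ ‖p‖` on `K_w` gives `ν x ≤ ν p` on `L_w`. [cite: SerreLocalFields1979, Ch. II §1] -/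
theorem val_le_val_prime_of_norm_le {x : Kw p L w} (hx : ‖x‖ ≤ ‖((p : ℕ) : Kw p L w)‖) :
    ν (toCompletion p L w x) ≤ ν ((p : ℕ) : w.1.adicCompletion L) := by
  have hequiv := valuation_isEquiv_of_compatible (p := p) w ν
  have h1 : NormedField.valuation (K := Kw p L w) x ≤ NormedField.valuation (K := Kw p L w) ((p : ℕ) : Kw p L w) := by
    rw [NormedField.valuation_apply, NormedField.valuation_apply, ← NNReal.coe_le_coe, coe_nnnorm, coe_nnnorm]
    exact hx
  have h2 := (hequiv _ _).mp h1
  rwa [Valuation.comap_apply, Valuation.comap_apply, map_natCast] at h2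

/-- ★ **`p` odd, `w` unramified: every `y ∈ p𝒪_w` is `log_ω^{ν}(P′)` for some `P′ ∈ E₁^{ν}(W ⊗ L_w)`** —
the surjectivity half of `log_ω : E₁(L_w) ⥲ p𝒪_w`, for `W/ℚ` globally minimal of ANY reduction type at `p`,
`L : Type` any number field, EVERY compatible `ν` (gen 5 (G6) `exists_mem_kernel_satLog_eq_of_odd` on `K_w`,
moved along §2). [cite: SilvermanAEC2009, Thm. IV.6.4 with Prop. VII.2.2] -/
theorem exists_mem_kernel_padicLogPointFiniteExt_eq_of_val_le (hp2 : p ≠ 2) {y : w.1.adicCompletion L}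
    (hy : ν y ≤ ν ((p : ℕ) : w.1.adicCompletion L)) :
    ∃ P' : (W.baseChange (w.1.adicCompletion L)).toAffine.Point,
      P' ∈ kernel ν (W.baseChange (w.1.adicCompletion L)) ∧
      padicLogPointFiniteExt ν (W.baseChange (w.1.adicCompletion L)) p P' = y := by
  obtain ⟨P, hP, hPy, -⟩ := exists_mem_kernel_satLog_eq_of_odd (p := p) (K := Kw p L w)
    (M := (integralModelInt W).map (Int.castRingHom ℤ_[p])) hp2 (norm_le_norm_prime_of_val_le (p := p) w ν hy)
  obtain ⟨P', hP'k, hP'l⟩ := exists_mem_kernel_padicLogPointFiniteExt_eq_satLog (p := p) w W ν hP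
  refine ⟨P', hP'k, ?_⟩
  rw [hP'l, hPy]
  rfl

/-- **`p` odd, `w` unramified: `ν(log_ω^{ν} P′) ≤ ν p` for every `P′ ∈ E₁^{ν}(W ⊗ L_w)`** — the containment
`log_ω(E₁(L_w)) ⊆ p𝒪_w` (gen 5 (G6) `norm_ptLog_le_norm_prime_of_unramified` on `K_w`, whose unramified
normalisation is gen 2's `Kw.norm_le_norm_prime_of_norm_lt_one`, moved along §2).
[cite: SilvermanAEC2009, Thm. IV.6.4 with Prop. VII.2.2] -/
theorem val_padicLogPointFiniteExt_le_of_mem_kernel (hp2 : p ≠ 2)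
    {P' : (W.baseChange (w.1.adicCompletion L)).toAffine.Point}
    (hP' : P' ∈ kernel ν (W.baseChange (w.1.adicCompletion L))) :
    ν (padicLogPointFiniteExt ν (W.baseChange (w.1.adicCompletion L)) p P') ≤ ν ((p : ℕ) : w.1.adicCompletion L) := by
  obtain ⟨P, hP, hPl⟩ := exists_mem_kernel_satLog_eq_padicLogPointFiniteExt (p := p) w W ν hP'
  rw [← hPl]
  refine val_le_val_prime_of_norm_le (p := p) w ν ?_
  rw [satLog_of_mem hP]
  exact norm_ptLog_le_norm_prime_of_unramified hp2 (fun x hx => norm_le_norm_prime_of_norm_lt_one he.out x hx) hP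

/-- ★★ **`log_ω^{ν}(E₁^{ν}(W ⊗ L_w)) = p𝒪_w = {y : ν y ≤ ν p}`** at an UNRAMIFIED place `w ∣ p`, `p` odd, for
`W/ℚ` globally minimal of ANY reduction type at `p` and EVERY compatible `ν` — the top layer of the lattice
lemma's Part D (Silverman IV.6.4(b) at `r = v(p)`). [cite: SilvermanAEC2009, Thm. IV.6.4 with Prop. VII.2.2] -/
theorem image_padicLogPointFiniteExt_kernel_eq (hp2 : p ≠ 2) :
    padicLogPointFiniteExt ν (W.baseChange (w.1.adicCompletion L)) p ''
        (kernel ν (W.baseChange (w.1.adicCompletion L)) : Set _) =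
      {y : w.1.adicCompletion L | ν y ≤ ν ((p : ℕ) : w.1.adicCompletion L)} := by
  ext y
  constructor
  · rintro ⟨P', hP', rfl⟩
    exact val_padicLogPointFiniteExt_le_of_mem_kernel (p := p) w W ν hp2 hP'
  · intro hy
    obtain ⟨P', hP', hP'y⟩ := exists_mem_kernel_padicLogPointFiniteExt_eq_of_val_le (p := p) w W ν hp2 hy
    exact ⟨P', hP', hP'y⟩

end Log

end Kw

end Summit.BirchSwinnertonDyer.BirchSwinnertonDyer.Theorems.KPort

end
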